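import Summits.AtomisticToContinuum.HydrodynamicLimit.Theorems.OneFlightGossipEngineClampedTransferDockWindowClauseRate
import Summits.AtomisticToContinuum.HydrodynamicLimit.Theorems.OneFlightGossipEngineClampedTransferDockSeet
import Summits.AtomisticToContinuum.HydrodynamicLimit.Theorems.ImplosionDichotomyHydroLimitInBandSignedBandDefs
import HarnessLib

/-!
# The one-window ledger at a rate, D-shape, over the SIGNED cubic channel (stub `stub_windowClauseRateS`, line
# `IdeatorOneSketch` v16, crux `HydroLimitInBand`, stmt-AtomisticToContinuum-9133)

Support file (`--supports stmt-AtomisticToContinuum-9133`) proving the registered stub `stub_windowClauseRateS : WindowClauseRateS` of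
the skeleton v16 of the line `IdeatorOneSketch` (the def is the one of the landed statements file
`Theorems/ImplosionDichotomyHydroLimitInBandSignedBandDefs.lean`, namespace `HydroLimitInBandSignedBand`, imported — not re-declared).
QUANTIFIER PLUMBING ONLY: `WindowClauseRateS` has the byte-identical conclusion of the landed
`ClampedTransferDockRate.WindowClauseRate` (`Theorems/OneFlightGossipEngineClampedTransferDockWindowClauseRate.lean`, 17615-0) and differs
only in its antecedents — the rate cubic channel is the SIGNED one `CubicChannelRateS` (band input KCWF-Q
`KineticCurrentsLDAlongFamiliesQ` and the static band truncation `BandShiftStatics` in place of the refuted `BandCoherenceLDFamily`), and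
KC1 is `KineticInstanceOrth` (the landed kinetic instance with the momentum-orthogonality `(b·w)G ⊥ v_k` of its cut-off exported, which
is exactly the extra hypothesis of the signed channel). The proof is the landed `stub_windowClauseRate` verbatim with four edits:
(1) the new antecedent list; (2) KC1 read from `KineticInstanceOrth` (one extra component `hGorth`); (3) the signed channel fed with
`BandShiftStatics`, `windowFlowShift`, KCWF-Q, SEET; (4) `hGorth` passed to the channel's band coefficient. Everything else (thresholds
`ηw`, `σ₀`, the rate bookkeeping `c ↦ (A, K₀) ↦ K₁ ↦ (K, ε)`, `τ`, `N₀`, the window estimate, `ledger_step`) is unchanged.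
prover-line-stmt-AtomisticToContinuum-9133-c17-0 (stub worker `stub_windowClauseRateS`).
-/

noncomputable section

open MeasureTheory Filter Set Topology InformationTheory
open scoped ENNReal

namespace Summit.AtomisticToContinuum.HydrodynamicLimit.Theorems.HydroLimitInBandWindowClauseS

open Literature.MathematicalPhysics.KineticTheory Literature.Analysis.FluidPDE Literature.Analysis.FunctionSpaces
open Summit.AtomisticToContinuum.HydrodynamicLimit.Theses
open Summit.AtomisticToContinuum.HydrodynamicLimit.Theorems
open Summit.AtomisticToContinuum.HydrodynamicLimit.Theorems.HydroLimitInBandSignedBand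
  (KineticCurrentsLDAlongFamiliesQ BandShiftStatics KineticInstanceOrth CubicChannelRateS WindowClauseRateS)
open Summit.AtomisticToContinuum.HydrodynamicLimit.Theorems.ClampedTransferDockRate
  (exists_level_exp_small rate_budget ledger_step)

/-! ## The stub -/

set_option maxHeartbeats 400000 in -- one declaration: the whole threshold bookkeeping of the one-window ledger (as the template)
/-- **STUB `stub_windowClauseRateS : WindowClauseRateS` — Yau's one-window entropy ledger at a rate, D-shape, over the signed cubic
channel** (line `IdeatorOneSketch` v16, crux `HydroLimitInBand`): thresholds `ηw` (EOS window, KC1/LC1 guards, statics, static clause,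
activity inversion, signed rate cubic channel), `σ₀` (signed channel, CC3, ECT, 1/2); on `(0, t)`: `K⋆` → KC1-orth (`G`, `hGorth`, `β₀ᴷ`)
→ `B` → LC1 (`V`, `β₀ᶜ`) → `β` → freeze constant → `M₃` → `Cst`; for a target `δ`: `c := 2Bt+1 ↦ (A, K₀) ↦ K₁ ↦ (K, ε)`, then
`ε′ ↦ (ε₁, ε₃, τ, N₀)` and per window C0 + `stub_windowEstimateRate` + the a-priori bound. Adapted verbatim from
`ClampedTransferDockRate.stub_windowClauseRate`. [cite: Yau1991, §2; OllaVaradhanYau1993, §3] -/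
theorem stub_windowClauseRateS : WindowClauseRateS := by
  intro hWE hCCR hBS hKIO hKQ hSeet hLC hCEAT hKC hCAT hECT r Rf hr hana hLip hsol hbd hcont huniq η₀ hη₀ _HU
  -- adapted from Theorems/OneFlightGossipEngineClampedTransferDockWindowClauseRate.lean (stub_windowClauseRate, 17615-0)
  obtain ⟨η₁, hη₁, _hη₁r, F, hF, hZF, hRfF⟩ := ClampedCurrentsDockHeart.eosBridge hr hsol hbd hcont huniq
  -- (2) KC1 with the orthogonality of its cut-off exported
  obtain ⟨ηK, hηK, HK⟩ := hKIO hKC ClampedCurrentsDockCutoffFamily.stub_loHeatFluxCutoffFamily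
  obtain ⟨ηC, hηC, HC⟩ := ClampedCurrentsDockLocalInstance.stub_localCollisionalInstance hLC
  obtain ⟨ηs, hηs, HS⟩ := ClampedCurrentsDockStaticLimit.stub_staticLimit r Rf hr hana hLip hsol hbd hcont huniq
  obtain ⟨ηsc, hηsc, HSC⟩ := HydroLimitInBandHeart.stub_staticClause r Rf hr hana hLip hsol hbd hcont huniq
  -- (3) the SIGNED rate cubic channel: its packing guard `ηQ`
  obtain ⟨ηQ, hηQ, HQ⟩ := hCCR hBS ClampedCurrentsDockFlowShiftFreeze.windowFlowShift hKQ hSeet r Rf hr hbd hcont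
  set ηA : ℝ := min (r / (2 * (2 * (2 * Real.exp 1 + 1)))) (1 / (64 * Real.exp 1 * v₁)) with hηA
  have hηA0 : 0 < ηA := by have := v₁_pos; have := Real.exp_pos 1; positivity
  set ηw : ℝ := min (min (min (η₁ / 2) (min (ηK / 2) (ηC / 2))) (min ηs ηA)) (min ηQ ηsc) with hηw
  have hηw0 : 0 < ηw := by positivity
  have hηw1 : ηw ≤ η₁ / 2 := (min_le_left _ _).trans ((min_le_left _ _).trans (min_le_left _ _))
  have hηwK : ηw ≤ ηK / 2 := (min_le_left _ _).trans ((min_le_left _ _).trans ((min_le_right _ _).trans (min_le_left _ _)))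
  have hηwC : ηw ≤ ηC / 2 := (min_le_left _ _).trans ((min_le_left _ _).trans ((min_le_right _ _).trans (min_le_right _ _)))
  have hηws : ηw ≤ ηs := (min_le_left _ _).trans ((min_le_right _ _).trans (min_le_left _ _))
  have hηwA : ηw ≤ ηA := (min_le_left _ _).trans ((min_le_right _ _).trans (min_le_right _ _))
  have hηwQ : ηw ≤ ηQ := (min_le_right _ _).trans (min_le_left _ _)
  have hηwsc : ηw ≤ ηsc := (min_le_right _ _).trans (min_le_right _ _)
  have hηwr : ηw ≤ r := by
    have : ηA ≤ r / (2 * (2 * (2 * Real.exp 1 + 1))) := min_le_left _ _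
    have h2 : r / (2 * (2 * (2 * Real.exp 1 + 1))) ≤ r := by rw [div_le_iff₀ (by positivity)]; nlinarith [Real.exp_pos 1]
    linarith
  refine ⟨ηw, hηw0, fun a₀ θ₀ u₀ ha hθ hu ha0 hθ0 => ?_⟩
  obtain ⟨σQ, hσQ, HQσ⟩ := HQ a₀ θ₀ u₀ ha hθ hu ha0 hθ0
  obtain ⟨σT, hσT, HT⟩ := ClampedCurrentsDockTransferTails.stub_transferActivityTails hCAT hCEAT a₀ θ₀ u₀ ha hθ hu ha0 hθ0
  obtain ⟨σE, hσE, HE⟩ := hECT a₀ θ₀ u₀ ha hθ hu ha0 hθ0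
  refine ⟨min (min σQ σT) (min σE (1 / 2)), lt_min (lt_min hσQ hσT) (lt_min hσE (by norm_num)),
    fun σ hσ hσlt T ρ θ u hE hguard Φ htie t ht => ?_⟩
  have hσQ' : σ < σQ := hσlt.trans_le ((min_le_left _ _).trans (min_le_left _ _))
  have hσT' : σ < σT := hσlt.trans_le ((min_le_left _ _).trans (min_le_right _ _))
  have hσE' : σ < σE := hσlt.trans_le ((min_le_right _ _).trans (min_le_left _ _))
  have hσ2 : σ < 1 / 2 := hσlt.trans_le ((min_le_right _ _).trans (min_le_right _ _))
  have hσ3 : 0 < σ ^ 3 := pow_pos hσ 3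
  have ht0 : 0 < t := ht.1
  have htI : t ∈ Ico 0 T := ⟨ht.1.le, ht.2⟩
  have hIt : Icc 0 t ⊆ Ico 0 T := fun s hs => ⟨hs.1, hs.2.trans_lt ht.2⟩
  have hmass : ∀ s ∈ Ico 0 T, ∫ x, ρ s x = 1 := fun s hs => (DenseExcursionEverywhere.integral_density_eq hE hs).trans
    (DenseExcursionEverywhere.integral_density_zero_eq_one hσ2.le ha hθ hu ha0 hθ0 Φ htie)
  have hgs : ∀ s ∈ Ico 0 T, ∀ x, ρ s x * σ ^ 3 < ηs := fun s hs x => (hguard s hs x).trans_le hηws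
  have hgsc : ∀ s ∈ Ico 0 T, ∀ x, ρ s x * σ ^ 3 < ηsc := fun s hs x => (hguard s hs x).trans_le hηwsc
  have hgQ : ∀ s ∈ Ico 0 T, ∀ x, ρ s x * σ ^ 3 < ηQ := fun s hs x => (hguard s hs x).trans_le hηwQ
  have hg1 : ∀ s ∈ Ico 0 T, ∀ x, ρ s x * σ ^ 3 ∈ Ioo 0 η₁ := fun s hs x =>
    ⟨mul_pos (hE.density_pos s hs x) hσ3, (hguard s hs x).trans_le (hηw1.trans (by linarith))⟩
  have hg12 : ∀ s ∈ Icc 0 t, ∀ x, ρ s x * σ ^ 3 < η₁ / 2 := fun s hs x => (hguard s (hIt hs) x).trans_le hηw1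
  have hgr : ∀ s ∈ Icc 0 t, ∀ x, ρ s x * σ ^ 3 < r := fun s hs x => (hguard s (hIt hs) x).trans_le hηwr
  -- the explicit reference family: smooth and positive on `[0,T)` (SC-b)
  obtain ⟨hasm, hapos, -, -, -, -⟩ := HS σ hσ hσ2 T ρ θ u hE hgs hmass Φ t ht
  have hasm' : Torus.IsSmoothSpaceTimeOn (Ico 0 T) (fun s x => ρ s x * Rf (σ ^ 3 * ρ s x)) := hasm
  have hapos' : ∀ s ∈ Ico 0 T, ∀ x, 0 < (fun s x => ρ s x * Rf (σ ^ 3 * ρ s x)) s x := hapos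
  have hac : ∀ s ∈ Ico 0 T, Continuous fun x => ρ s x * Rf (σ ^ 3 * ρ s x) := fun s hs => (hasm'.isSmooth_slice hs).continuous
  have hρc : ∀ s ∈ Ico 0 T, Continuous (ρ s) := fun s hs => (hE.smooth_density.isSmooth_slice hs).continuous
  -- the guards of KC1 / LC1 along the family (`guard_of_band_min` of the rate cubic channel's file)
  have hguardX : ∀ {ηX : ℝ}, 2 * ηw ≤ ηX → ∀ s ∈ Icc 0 t,
      σ ^ 3 * (⨆ x, ρ s x * Rf (σ ^ 3 * ρ s x)) ≤ ηX * ∫ x, ρ s x * Rf (σ ^ 3 * ρ s x) :=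
    fun hX s hs => ClampedTransferDockCubicRate.guard_of_band_min hbd hσ (hE.density_pos s (hIt hs)) (hmass s (hIt hs))
      (fun x => (hguard s (hIt hs) x).trans_le (le_min (by linarith) hηwr)) (hρc s (hIt hs)) (hac s (hIt hs))
  have hguardK : ∀ s ∈ Icc 0 t, σ ^ 3 * (⨆ x, (fun s x => ρ s x * Rf (σ ^ 3 * ρ s x)) s x) ≤
      ηK * ∫ x, (fun s x => ρ s x * Rf (σ ^ 3 * ρ s x)) s x := hguardX (by linarith)
  have hguardC : ∀ s ∈ Icc 0 t, σ ^ 3 * (⨆ x, ρ s x * Rf (σ ^ 3 * ρ s x)) ≤ ηC * ∫ x, ρ s x * Rf (σ ^ 3 * ρ s x) :=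
    hguardX (by linarith)
  -- (3) the signed rate cubic channel: the suprathermal level `K⋆`
  obtain ⟨Kstar, hKstar, HQK⟩ := HQσ σ hσ hσQ' T ρ θ u hE hgQ Φ htie t htI
  -- KC1 along the solution on the slab `[0,t]`
  have hθsmI : Torus.IsSmoothSpaceTimeOn (Icc 0 t) θ := hE.smooth_temperature.mono hIt
  have husmI : Torus.IsSmoothSpaceTimeOn (Icc 0 t) u := hE.smooth_velocity.mono hIt
  have haconI : ContinuousOn (Function.uncurry fun s x => ρ s x * Rf (σ ^ 3 * ρ s x)) (Icc 0 t ×ˢ univ) :=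
    (ClampedCurrentsDockHeart.continuousOn_uncurry_of_isSmoothSpaceTimeOn hasm').mono (prod_mono hIt subset_rfl)
  -- (2) KC1-orth: one extra component `hGorth`
  obtain ⟨G, hGc, ⟨CG, hCG⟩, hGagree, hGorth, β₀K, hβ₀K, HKβ⟩ := HK t (fun s x => ρ s x * Rf (σ ^ 3 * ρ s x)) θ u ht.1.le
    haconI (fun s hs => hapos' s (hIt hs)) hθsmI husmI (fun s hs => hE.temperature_pos s (hIt hs)) σ hσ hguardK Φ Kstar hKstar
  set CG' : ℝ := max CG 0 with hCG'
  have hCG'0 : 0 ≤ CG' := le_max_right _ _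
  have hCG'b : ∀ s ∈ Icc 0 t, ∀ y : T3 × ℝ, 0 ≤ y.2 → |G s y| ≤ CG' := fun s hs y hy => (hCG s hs y hy).trans (le_max_left _ _)
  -- (4) the signed rate cubic channel at the cut-off profile: the band coefficient `B` (the orthogonality `hGorth` passed)
  obtain ⟨B, hB0, HQB⟩ := HQK G CG' hCG'0 hGc hCG'b hGagree hGorth
  -- LC1 along the CLAMPED families (globally continuous), read on the slab
  set cl : ℝ → ℝ := ClampedCurrentsDockHeart.clampTime t with hcl_def
  have hclm : ∀ s, cl s ∈ Icc 0 t := fun s => ClampedCurrentsDockHeart.clampTime_mem ht.1.le s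
  have hclI : ∀ s, cl s ∈ Ico 0 T := fun s => hIt (hclm s)
  set ac : ℝ → T3 → ℝ := fun s x => ρ (cl s) x * Rf (σ ^ 3 * ρ (cl s) x) with hac_def
  set θc : ℝ → T3 → ℝ := fun s => θ (cl s) with hθc_def
  set uc : ℝ → T3 → V3 := fun s => u (cl s) with huc_def
  have hacc : ∀ s, Continuous (ac s) := fun s => hac _ (hclI s)
  have hac0 : ∀ s x, 0 < ac s x := fun s x => hapos' _ (hclI s) x
  have hθc0 : ∀ s x, 0 < θc s x := fun s x => hE.temperature_pos _ (hclI s) x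
  have hacu : Continuous (Function.uncurry ac) := ClampedCurrentsDockHeart.continuous_uncurry_clamp ht.1.le haconI
  have hθcu : Continuous (Function.uncurry θc) := ClampedCurrentsDockHeart.continuous_uncurry_clamp ht.1.le
    ((ClampedCurrentsDockHeart.continuousOn_uncurry_of_isSmoothSpaceTimeOn hE.smooth_temperature).mono (prod_mono hIt subset_rfl))
  have hucu : Continuous (Function.uncurry uc) := ClampedCurrentsDockHeart.continuous_uncurry_clamp ht.1.le
    ((ClampedCurrentsDockHeart.continuousOn_uncurry_of_isSmoothSpaceTimeOn hE.smooth_velocity).mono (prod_mono hIt subset_rfl))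
  have hcl_id : ∀ s ∈ Icc 0 t, cl s = s := fun s hs => ClampedCurrentsDockHeart.clampTime_of_mem hs
  have hθcsm : Torus.IsSmoothSpaceTimeOn (Icc 0 t) θc :=
    ClampedCurrentsDockHeart.isSmoothSpaceTimeOn_congr hθsmI fun s hs => by simp only [hθc_def, hcl_id s hs]
  have hucsm : Torus.IsSmoothSpaceTimeOn (Icc 0 t) uc :=
    ClampedCurrentsDockHeart.isSmoothSpaceTimeOn_congr husmI fun s hs => by simp only [huc_def, hcl_id s hs]
  have hguardCc : ∀ s ∈ Icc 0 t, σ ^ 3 * (⨆ x, ac s x) ≤ ηC * ∫ x, ac s x := fun s hs => by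
    simp only [hac_def, hcl_id s hs]
    exact hguardC s hs
  obtain ⟨V₀C, _hV₀C, HCV⟩ := HC t ac θc uc hacc hacu hθcu hucu hac0 hθc0 hθcsm hucsm σ hσ hσ2 hguardCc Φ
  -- CC3: transfer-activity tails
  obtain ⟨V₀T, hV₀T, HTV⟩ := HT σ hσ hσT' T ρ θ u hE Φ htie t htI
  set V : ℝ := max V₀C V₀T with hV
  have hV0 : 0 ≤ V := hV₀T.le.trans (le_max_right _ _)
  obtain ⟨β₀C, hβ₀C, HCβ⟩ := HCV V (le_max_left _ _)
  -- the tilt, fixed before `δ`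
  set β : ℝ := min β₀K β₀C with hβ
  have hβ0 : 0 < β := lt_min hβ₀K hβ₀C
  have hβK : |(-β)| ≤ β₀K := by rw [abs_neg, abs_of_pos hβ0]; exact min_le_left _ _
  have hβC : |(-β)| ≤ β₀C := by rw [abs_neg, abs_of_pos hβ0]; exact min_le_right _ _
  -- FZ: the freeze constant (also the common Lipschitz constant of the test functions)
  obtain ⟨Cfz, hCfz0, HFZ⟩ := ClampedCurrentsDockFlowShiftFreeze.freezeBounds σ T ρ θ u η₁ F hE hσ hη₁ hF hZF t ht hg12
  -- ECT at accuracy one: the third-moment level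
  obtain ⟨M₃, N₀E, HEN⟩ := HE σ hσ hσE' T ρ θ u hE Φ htie t htI 1 one_pos
  -- the static clause: `Cst` and the statics
  obtain ⟨hCst, hstat⟩ := HSC a₀ θ₀ u₀ ha hθ hu ha0 hθ0 σ hσ hσ2 T ρ θ u hE hgsc Φ htie t ht
  refine ⟨_, hCst, hstat, fun δ hδ => ?_⟩
  -- the rate bookkeeping for the target `δ`: `c := 2Bt + 1 ↦ (A, K₀) ↦ K₁ ↦ (K, ε)`
  obtain ⟨A, hA0, K₀, hK₀, HQc⟩ := HQB (2 * B * t + 1) (by positivity)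
  obtain ⟨K₁, hK₁, hK₁b⟩ := exists_level_exp_small K₀ (4 * (1 + t) * A * Real.exp (10 * t / β)) (δ / 2) (half_pos hδ)
  have hK₁0 : 0 ≤ K₁ := hK₀.le.trans hK₁
  set S : ℝ := A * Real.exp (-((2 * B * t + 1) * K₁)) with hS
  have hS0 : 0 ≤ S := by positivity
  set ε₀ : ℝ := δ * Real.exp (-(2 * (5 / β + B * K₁) * t)) / (8 * (1 + t)) with hε₀
  have hε₀0 : 0 < ε₀ := by positivity
  refine ⟨5 / β + B * K₁, by positivity, ε₀ + S, by positivity, rate_budget ht0 hK₁b, ?_⟩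
  set ε' : ℝ := min ε₀ 1 with hε'
  have hε'0 : 0 < ε' := lt_min hε₀0 one_pos
  have hε'1 : ε' ≤ 1 := min_le_right _ _
  have hε'ε : ε' ≤ ε₀ := min_le_left _ _
  set ε₁ : ℝ := β * ε' / 10 with hε₁
  have hε₁0 : 0 < ε₁ := by positivity
  set ε₃ : ℝ := ε' / (40 * (Cfz + 1)) with hε₃
  have hε₃0 : 0 < ε₃ := by positivity
  -- the window parameter `τ`
  obtain ⟨τK, hτK, HKτ⟩ := HKβ (-β) hβK ε₁ hε₁0
  obtain ⟨τC, _hτC, HCτ⟩ := HCβ (-β) hβC (ε₁ / 4) (by positivity)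
  obtain ⟨τQ, _hτQ, HQτ⟩ := HQc K₁ hK₁ (ε' / 10) (by positivity)
  obtain ⟨τT, _hτT, HTτ⟩ := HTV V (le_max_right _ _) ε₃ hε₃0
  set τ : ℝ := max (max τK τC) (max τQ τT) with hτ_def
  have hτ0 : 0 < τ := hτK.trans_le ((le_max_left _ _).trans (le_max_left _ _))
  obtain ⟨NK, HKN⟩ := HKτ τ ((le_max_left _ _).trans (le_max_left _ _))
  obtain ⟨NC, HCN⟩ := HCτ τ ((le_max_right _ _).trans (le_max_left _ _))
  obtain ⟨NQ, HQN⟩ := HQτ τ ((le_max_left _ _).trans (le_max_right _ _))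
  obtain ⟨NT, HTN⟩ := HTτ τ ((le_max_right _ _).trans (le_max_right _ _))
  -- `N` large enough for the freeze errors
  obtain ⟨Nsm, Hsm⟩ := eventually_atTop.1 ((ClampedCurrentsDockCubicChannelPrelim.tendsto_window_zero
    (Cfz * τ * (40 * (2 * (max M₃ 0) ^ 3 + 6 + V)))).eventually (Iic_mem_nhds hε'0))
  refine ⟨τ, hτ0, max (max (max NK NC) (max NQ NT)) (max N₀E Nsm), fun N hN s hs0 hsw => ?_⟩
  simp only [max_le_iff] at hN
  obtain ⟨⟨⟨hNK, hNC⟩, hNQ, hNT⟩, hNE, hNsm⟩ := hN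
  -- the window
  set w : ℝ := τ * ((N : ℝ) + 1) ^ (-(1 / 3 : ℝ)) with hw_def
  have hw0 : 0 < w := mul_pos hτ0 (Real.rpow_pos_of_pos (by positivity) _)
  have hsw' : s ≤ s + w := le_add_of_nonneg_right hw0.le
  have hsI : s ∈ Icc 0 t := ⟨hs0, hsw'.trans hsw⟩
  have hsT : s ∈ Ico 0 T := hIt hsI
  have hswT : s + w < T := hsw.trans_lt ht.2
  have hρsc : Continuous (ρ s) := hρc s hsT
  have hρs0 : ∀ x, 0 < ρ s x := hE.density_pos s hsT
  -- C0: the one-window balance (identity + integrability)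
  obtain ⟨hStrI, hColI, hbal⟩ := ClampedCurrentsDockWindowBalance.stub_windowBalance σ T N (Φ N) a₀ θ₀ u₀
    (fun s x => ρ s x * Rf (σ ^ 3 * ρ s x)) θ u hσ hσ2 ha hθ hu ha0 hθ0 hasm' hE.smooth_temperature hE.smooth_velocity hapos'
    hE.temperature_pos s w hs0 hw0.le hswT
  -- KC1 at `(N, s)`
  have hKs := HKN N hNK s hsI
  -- LC1 at `(N, s)`: read at the solution's fields and at `ρ₀ = ρ_s` (activity inversion)
  have hcls : cl s = s := hcl_id s hsI
  have hpackA : σ ^ 3 * (⨆ x, ρ s x) ≤ min (r / (2 * (2 * (2 * Real.exp 1 + 1)))) (1 / (64 * Real.exp 1 * v₁)) := by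
    have hbdd : BddAbove (Set.range (ρ s)) := (isCompact_range hρsc).bddAbove
    obtain ⟨xM, -, hxM⟩ := isCompact_univ.exists_isMaxOn univ_nonempty hρsc.continuousOn
    have hsup : (⨆ x, ρ s x) = ρ s xM :=
      le_antisymm (ciSup_le fun x => (isMaxOn_iff.mp hxM) x (mem_univ x)) (le_ciSup hbdd xM)
    rw [hsup, mul_comm]
    exact ((hguard s hsT xM).trans_le hηwA).le
  have key : ∀ (f : T3 → ℝ) (hf : Continuous f) (hf0 : ∀ x, 0 < f x), f = (fun x => ρ s x * Rf (σ ^ 3 * ρ s x)) →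
      rhoLim (profileOf f hf hf0) σ = ρ s := by
    rintro f hf hf0 rfl
    obtain ⟨_, _, -, -, h⟩ := EntropyClockDock.activity_of_density hr hsol hbd hcont huniq hσ hσ2 hρsc hρs0 (hmass s hsT) hpackA
    exact h
  have hρ₀ : rhoLim (profileOf (ac s) (hacc s) (hac0 s)) σ = ρ s :=
    key (ac s) (hacc s) (hac0 s) (by simp only [hac_def, hcls])
  obtain ⟨hCm', hCe'⟩ := HCN N hNC s hsI
  have hCm := fun k : Fin 3 => hCm' k
  have hCe := hCe'
  simp only [hρ₀] at hCm hCe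
  simp only [hac_def, hθc_def, huc_def, hcls] at hCm hCe
  -- CC3 at `(N, s)`, ECT on the window
  have hTs := HTN N hNT s hsI
  have HEN' : ∀ r' ∈ Icc s (s + w), ∫⁻ z, ENNReal.ofReal (((N : ℝ) + 1)⁻¹ * ∑ i : Fin (N + 1),
      Set.indicator {v : V3 | M₃ < ‖v‖} (fun v => ‖v‖ ^ 3) (((Φ N).flow r' z i).2)) ∂(localGibbsLaw σ a₀ u₀ θ₀ N (Φ N)) ≤
      ENNReal.ofReal 1 := fun r' hr' => HEN N hNE r' ⟨hs0.trans hr'.1, hr'.2.trans hsw⟩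
  -- the signed rate cubic channel at `(N, s)`: the slack `Q := w(N+1) A e^{-cK₁} + w (B K₁) H_N(s)`
  obtain ⟨Q, hQ⟩ : ∃ Q : ℝ, Q = w * ((N : ℝ) + 1) * S + w * (B * K₁) *
      (klDiv ((Φ N).lawAt (localGibbsLaw σ a₀ u₀ θ₀ N (Φ N)) s)
        (localGibbsLaw σ (fun x => ρ s x * Rf (σ ^ 3 * ρ s x)) (u s) (θ s) N (Φ N))).toReal := ⟨_, rfl⟩
  have hQ0 : 0 ≤ Q := hQ ▸ add_nonneg (by positivity) (mul_nonneg (by positivity) ENNReal.toReal_nonneg)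
  have hQe : w * ((N : ℝ) + 1) * (ε' / 10 + A * Real.exp (-((2 * B * t + 1) * K₁))) + w * (B * K₁) *
      (klDiv ((Φ N).lawAt (localGibbsLaw σ a₀ u₀ θ₀ N (Φ N)) s)
        (localGibbsLaw σ (fun x => ρ s x * Rf (σ ^ 3 * ρ s x)) (u s) (θ s) N (Φ N))).toReal =
      w * ((N : ℝ) + 1) * (ε' / 10) + Q := by
    rw [hQ, hS]; ring
  have hQs : _ ≤ ENNReal.ofReal (w * ((N : ℝ) + 1) * (ε' / 10) + Q) :=
    le_of_le_of_eq (HQN N hNQ s hs0 hsw) (congrArg ENNReal.ofReal hQe)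
  -- Lipschitz constants of the test functions at `s`, continuity and bound of the cut-off profile at `s`
  have hLipm : ∀ (k : Fin 3) (x y : T3), |u s x k / θ s x - u s y k / θ s y| ≤ Cfz * Torus.euclidDist x y :=
    fun k x y => ((HFZ s hsI s hsI x 0).2.2.2.2.1) k y
  have hLipe : ∀ x y : T3, |(-(θ s x)⁻¹) - (-(θ s y)⁻¹)| ≤ Cfz * Torus.euclidDist x y :=
    fun x y => ((HFZ s hsI s hsI x 0).2.2.2.2.2) y
  have hGs : Continuous (G s) := hGc.comp_continuous (continuous_const.prodMk continuous_id) fun y => ⟨hsI, mem_univ _⟩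
  have hCGs : ∀ y : T3 × ℝ, 0 ≤ y.2 → |G s y| ≤ CG' := fun y hy => hCG'b s hsI y hy
  have hsmall : Cfz * w * (40 * (2 * (max M₃ 0) ^ 3 + 6 + V)) ≤ ε' := by
    have h : Cfz * τ * (40 * (2 * (max M₃ 0) ^ 3 + 6 + V)) * ((N : ℝ) + 1) ^ (-(1 / 3 : ℝ)) ≤ ε' := Hsm N hNsm
    calc _ = Cfz * τ * (40 * (2 * (max M₃ 0) ^ 3 + 6 + V)) * ((N : ℝ) + 1) ^ (-(1 / 3 : ℝ)) := by rw [hw_def]; ring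
      _ ≤ ε' := h
  -- THE ONE-WINDOW ESTIMATE WITH SLACK (`stub_windowEstimateRate`; all implicit arguments given explicitly)
  have hWE' := @hWE σ T η₁ τ t s w V Cfz Cfz CG' β ε' ε₁ ε₃ M₃ Q N (Φ N) ρ θ u F Rf G a₀ θ₀ u₀
    ha hθ hu ha0 hθ0 hE hσ hσ2 hη₁ hF hZF hRfF hg1 hasm' hapos' ht hs0 hw0 hsw hτ0 hw_def hV0 hCfz0 hCfz0 hLipm hLipe hGs hCGs HFZ
    hβ0 hε'0 hε'1 hε₁ hε₃ hQ0 hsmall hKs hCm hCe hTs hQs HEN' hStrI hColI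
  -- the a-priori bound: the running supremum is a supremum
  obtain ⟨Bap, hBap⟩ := EntropyClockDock.ledgerAprioriBound r Rf hr hbd hcont a₀ θ₀ u₀ ha hθ hu ha0 hθ0 σ hσ hσ2 T ρ θ u hE t ht
    hgr N (Φ N)
  have hswI : Icc 0 (s + w) ⊆ Icc 0 t := Icc_subset_Icc_right hsw
  have hbdd : BddAbove ((fun s' => (klDiv ((Φ N).lawAt (localGibbsLaw σ a₀ u₀ θ₀ N (Φ N)) s')
      (localGibbsLaw σ (fun x => ρ s' x * Rf (σ ^ 3 * ρ s' x)) (u s') (θ s') N (Φ N))).toReal) '' Icc 0 (s + w)) := by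
    refine ⟨max Bap 0, ?_⟩
    rintro _ ⟨s', hs', rfl⟩
    exact ENNReal.toReal_le_of_le_ofReal (le_max_right _ _) ((hBap s' (hswI hs')).trans (ENNReal.ofReal_le_ofReal (le_max_left _ _)))
  have hHs_le : (klDiv ((Φ N).lawAt (localGibbsLaw σ a₀ u₀ θ₀ N (Φ N)) s)
      (localGibbsLaw σ (fun x => ρ s x * Rf (σ ^ 3 * ρ s x)) (u s) (θ s) N (Φ N))).toReal ≤
      sSup ((fun s' => (klDiv ((Φ N).lawAt (localGibbsLaw σ a₀ u₀ θ₀ N (Φ N)) s')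
        (localGibbsLaw σ (fun x => ρ s' x * Rf (σ ^ 3 * ρ s' x)) (u s') (θ s') N (Φ N))).toReal) '' Icc 0 (s + w)) :=
    le_csSup hbdd ⟨s, ⟨hs0, hsw'⟩, rfl⟩
  exact ledger_step hbal hWE' hQ hHs_le (by positivity) (by positivity) hε'ε

end Summit.AtomisticToContinuum.HydrodynamicLimit.Theorems.HydroLimitInBandWindowClauseS

end
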